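import Summits.Ventures.PercRepro.C026GluingHA

/-!
# H-walks between centrals contract to central–branch–central steps (generic)

Let `Cen` be a set of **centrals** of a multigraph and let every non-central carry a **branch**
label `br v` such that every edge is incident to a central or joins two vertices of one branch
(`hcover`).  For a configuration `S`, the H-graph of `C026HGraph` (`HAdj S c`) and an avoid set `X`
closed under `S`-connectivity, an H-walk avoiding `X` between two centrals can be contracted to a
walk whose steps are either one H-step between centrals or an excursion
`z → b₁ → ⋯ → b_k → z'` through ONE branch (`RelB`): `hConnAvoid_iff_relB`.

Nothing here depends on a particular gadget: the star gadget (hubs = one-vertex branches), the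
pure-pair gadget (two-vertex branches) and every bounded-branch family are instances.  The
one-vertex-branch form is `hConnAvoid_iff_relC` (`RelC`: one H-step, or a hub detour).

The symmetry of an H-step (`HAdj.symm`) is taken from `C026GluingHA`, which is the only reason
for that import (everything else here needs `C026HGraph` alone).
-/

namespace PercRepro

namespace MultiGraph

section HWalkCentral

variable {V E ι : Type*} (G : MultiGraph V E)

/-- An H-step inside the branch `i`, between non-centrals outside `X`. -/
def InBranch (S : Config E) (c : V) (Cen X : Set V) (br : V → ι) (i : ι) (x y : V) : Prop :=
  G.HAdj S c x y ∧ x ∉ Cen ∧ y ∉ Cen ∧ br x = i ∧ br y = i ∧ x ∉ X ∧ y ∉ X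

/-- One contracted step between centrals outside `X`: an H-step, or an excursion through one
branch — an H-step to a non-central `b₁`, H-steps inside the branch of `b₁`, an H-step back. -/
def RelB (S : Config E) (c : V) (Cen X : Set V) (br : V → ι) (z z' : V) : Prop :=
  z ∈ Cen ∧ z' ∈ Cen ∧ z ∉ X ∧ z' ∉ X ∧
    (G.HAdj S c z z' ∨ ∃ b₁ b₂, b₁ ∉ Cen ∧ b₁ ∉ X ∧ G.HAdj S c z b₁ ∧
      Relation.ReflTransGen (G.InBranch S c Cen X br (br b₁)) b₁ b₂ ∧ G.HAdj S c b₂ z')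

/-- The one-vertex-branch form (`br := id`): an H-step, or a detour through one non-central. -/
def RelC (S : Config E) (c : V) (Cen X : Set V) (z z' : V) : Prop :=
  z ∈ Cen ∧ z' ∈ Cen ∧ z ∉ X ∧ z' ∉ X ∧
    (G.HAdj S c z z' ∨ ∃ h, h ∉ Cen ∧ h ∉ X ∧ G.HAdj S c z h ∧ G.HAdj S c h z')

variable {G}

/-- The end of an in-branch walk from `b₁` is a non-central of the branch of `b₁`, outside `X`. -/
theorem InBranch.end_spec {S : Config E} {c : V} {Cen X : Set V} {br : V → ι} {i : ι} {b₁ b₂ : V}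
    (h : Relation.ReflTransGen (G.InBranch S c Cen X br i) b₁ b₂) (h₁ : b₁ ∉ Cen) (hX : b₁ ∉ X)
    (hi : br b₁ = i) : b₂ ∉ Cen ∧ b₂ ∉ X ∧ br b₂ = i := by
  induction h with
  | refl => exact ⟨h₁, hX, hi⟩
  | tail _ hxy _ => exact ⟨hxy.2.2.1, hxy.2.2.2.2.2.2, hxy.2.2.2.2.1⟩

/-- An in-branch walk is an H-walk avoiding `X`. -/
theorem InBranch.hConnAvoid {S : Config E} {c : V} {Cen X : Set V} {br : V → ι} {i : ι} {b₁ b₂ : V}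
    (h : Relation.ReflTransGen (G.InBranch S c Cen X br i) b₁ b₂) : G.HConnAvoid S c X b₁ b₂ := by
  induction h with
  | refl => exact Relation.ReflTransGen.refl
  | tail _ hxy ih => exact ih.tail ⟨hxy.1, hxy.2.2.2.2.2.1, hxy.2.2.2.2.2.2⟩

/-- A contracted step is an H-walk avoiding `X`. -/
theorem RelB.hConnAvoid {S : Config E} {c : V} {Cen X : Set V} {br : V → ι} {z z' : V}
    (h : G.RelB S c Cen X br z z') : G.HConnAvoid S c X z z' := by
  obtain ⟨_, _, hz, hz', hstep | ⟨b₁, b₂, hb₁, hb₁X, hzb, hwalk, hbz⟩⟩ := h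
  · exact Relation.ReflTransGen.single ⟨hstep, hz, hz'⟩
  · have hend := InBranch.end_spec hwalk hb₁ hb₁X rfl
    exact ((Relation.ReflTransGen.single ⟨hzb, hz, hb₁X⟩).trans (InBranch.hConnAvoid hwalk)).tail
      ⟨hbz, hend.2.1, hz'⟩

/-- In-branch steps are symmetric. -/
theorem InBranch.symm {S : Config E} {c : V} {Cen X : Set V} {br : V → ι} {i : ι} {x y : V}
    (h : G.InBranch S c Cen X br i x y) : G.InBranch S c Cen X br i y x :=
  ⟨h.1.symm, h.2.2.1, h.2.1, h.2.2.2.2.1, h.2.2.2.1, h.2.2.2.2.2.2, h.2.2.2.2.2.1⟩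

/-- Contracted steps are symmetric (so `hConnAvoid_iff_relB` turns H-connectivity between centrals
into reachability in the simple graph `SimpleGraph.fromRel (RelB …)`, decidable on finite types). -/
theorem RelB.symm {S : Config E} {c : V} {Cen X : Set V} {br : V → ι} {z z' : V}
    (h : G.RelB S c Cen X br z z') : G.RelB S c Cen X br z' z := by
  obtain ⟨hz, hz', hzX, hz'X, hstep | ⟨b₁, b₂, hb₁, hb₁X, hzb, hwalk, hbz⟩⟩ := h
  · exact ⟨hz', hz, hz'X, hzX, Or.inl hstep.symm⟩
  · have hend := InBranch.end_spec hwalk hb₁ hb₁X rfl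
    refine ⟨hz', hz, hz'X, hzX, Or.inr ⟨b₂, b₁, hend.1, hend.2.1, hbz.symm, ?_, hzb.symm⟩⟩
    rw [hend.2.2]
    clear hend hzb hbz
    induction hwalk with
    | refl => exact Relation.ReflTransGen.refl
    | tail _ hxy ih => exact ih.head hxy.symm

/-- One-vertex contracted steps are symmetric. -/
theorem RelC.symm {S : Config E} {c : V} {Cen X : Set V} {z z' : V}
    (h : G.RelC S c Cen X z z') : G.RelC S c Cen X z' z := by
  obtain ⟨hz, hz', hzX, hz'X, hstep | ⟨b, hb, hbX, hzb, hbz⟩⟩ := h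
  · exact ⟨hz', hz, hz'X, hzX, Or.inl hstep.symm⟩
  · exact ⟨hz', hz, hz'X, hzX, Or.inr ⟨b, hb, hbX, hbz.symm, hzb.symm⟩⟩

/-- **Branch lemma.** If `w` and `w'` are non-centrals of different branches that are
`S`-connected, the open path between them passes through a central connected to `w`. -/
theorem exists_central_of_conn_of_ne_branch {S : Config E} {Cen : Set V} {br : V → ι}
    (hcover : ∀ e, G.fst e ∈ Cen ∨ G.snd e ∈ Cen ∨ br (G.fst e) = br (G.snd e))
    {w w' : V} (hw : w ∉ Cen) (hconn : G.Conn S w w') (hne : br w' ≠ br w) :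
    ∃ z, z ∈ Cen ∧ G.Conn S w z := by
  have key : ∀ {v : V}, G.Conn S w v → (∃ z, z ∈ Cen ∧ G.Conn S w z) ∨ (v ∉ Cen ∧ br v = br w) := by
    intro v hv
    refine Conn.induction (motive := fun v => (∃ z, z ∈ Cen ∧ G.Conn S w z) ∨ (v ∉ Cen ∧ br v = br w))
      (Or.inr ⟨hw, rfl⟩) ?_ hv
    intro a b hwa hab ih
    rcases ih with ih | ⟨haC, hab'⟩
    · exact Or.inl ih
    by_cases hbC : b ∈ Cen
    · exact Or.inl ⟨b, hbC, hwa.tail hab⟩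
    refine Or.inr ⟨hbC, ?_⟩
    obtain ⟨e, _, hend⟩ := hab
    rcases hend with ⟨rfl, rfl⟩ | ⟨rfl, rfl⟩
    · rcases hcover e with h | h | h
      · exact absurd h haC
      · exact absurd h hbC
      · exact h.symm.trans hab'
    · rcases hcover e with h | h | h
      · exact absurd h hbC
      · exact absurd h haC
      · exact h.trans hab'
  rcases key hconn with h | ⟨_, h⟩
  · exact h
  · exact absurd h hne

/-- **The contraction lemma** (branch form): between centrals, H-walks avoiding `X` are exactly the
walks of contracted steps `RelB`. -/
theorem hConnAvoid_iff_relB (S : Config E) (c : V) (Cen X : Set V) (br : V → ι)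
    (hcover : ∀ e, G.fst e ∈ Cen ∨ G.snd e ∈ Cen ∨ br (G.fst e) = br (G.snd e))
    (hX : ∀ u v, u ∉ X → G.Conn S u v → v ∉ X) {u v : V} (hu : u ∈ Cen) (hv : v ∈ Cen) :
    G.HConnAvoid S c X u v ↔ Relation.ReflTransGen (G.RelB S c Cen X br) u v := by
  constructor
  · intro h
    -- the invariant: at a central, a contracted walk from `u`; at a non-central, a contracted walk to
    -- a central `z`, an H-step `z → b₁`, and an in-branch walk `b₁ → w`
    have inv : ∀ {w : V}, G.HConnAvoid S c X u w →
        (w ∈ Cen ∧ Relation.ReflTransGen (G.RelB S c Cen X br) u w) ∨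
        (w ∉ Cen ∧ w ∉ X ∧ ∃ z b₁, z ∈ Cen ∧ z ∉ X ∧ Relation.ReflTransGen (G.RelB S c Cen X br) u z ∧
          b₁ ∉ Cen ∧ b₁ ∉ X ∧ G.HAdj S c z b₁ ∧
          Relation.ReflTransGen (G.InBranch S c Cen X br (br b₁)) b₁ w) := by
      intro w hw
      unfold HConnAvoid at hw
      induction hw with
      | refl => exact Or.inl ⟨hu, Relation.ReflTransGen.refl⟩
      | @tail w w' _ hstep ih =>
        obtain ⟨hadj, hwX, hw'X⟩ := hstep
        by_cases hw'C : w' ∈ Cen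
        · -- arriving at a central
          refine Or.inl ⟨hw'C, ?_⟩
          rcases ih with ⟨hwC, hR⟩ | ⟨hwC, _, z, b₁, hzC, hzX, hR, hb₁C, hb₁X, hzb, hwalk⟩
          · exact hR.tail ⟨hwC, hw'C, hwX, hw'X, Or.inl hadj⟩
          · exact hR.tail ⟨hzC, hw'C, hzX, hw'X, Or.inr ⟨b₁, w, hb₁C, hb₁X, hzb, hwalk, hadj⟩⟩
        · -- arriving at a non-central
          rcases ih with ⟨hwC, hR⟩ | ⟨hwC, _, z, b₁, hzC, hzX, hR, hb₁C, hb₁X, hzb, hwalk⟩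
          · -- from a central: start an excursion
            exact Or.inr ⟨hw'C, hw'X, w, w', hwC, hwX, hR, hw'C, hw'X, hadj, Relation.ReflTransGen.refl⟩
          · -- from a non-central: stay in the branch, or re-anchor at a central of the cluster
            have hbr : br w = br b₁ := (InBranch.end_spec hwalk hb₁C hb₁X rfl).2.2
            by_cases hsame : br w' = br b₁
            · exact Or.inr ⟨hw'C, hw'X, z, b₁, hzC, hzX, hR, hb₁C, hb₁X, hzb,
                hwalk.tail ⟨hadj, hwC, hw'C, hbr, hsame, hwX, hw'X⟩⟩
            · -- the H-step `w → w'` cannot be along an edge (different branches, no central):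
              -- it is the third disjunct of `HAdj`, an `S`-connection outside `M`
              have hconn : w ∉ G.cluster S c ∧ w' ∉ G.cluster S c ∧ G.Conn S w w' := by
                have noedge : ∀ e, ¬ G.Joins e w w' := by
                  intro e hj
                  rcases hj with ⟨h1, h2⟩ | ⟨h1, h2⟩
                  · rcases hcover e with h | h | h
                    · exact hwC (h1 ▸ h)
                    · exact hw'C (h2 ▸ h)
                    · exact hsame (by rw [← hbr, ← h1, ← h2, h])
                  · rcases hcover e with h | h | h
                    · exact hw'C (h1 ▸ h)
                    · exact hwC (h2 ▸ h)
                    · exact hsame (by rw [← hbr, ← h2, ← h1, h])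
                rcases hadj with ⟨_, _, e, _, hj⟩ | ⟨_, e, hj⟩ | h3
                · exact absurd hj (noedge e)
                · exact absurd hj (noedge e)
                · exact h3
              obtain ⟨hwM, hw'M, hww'⟩ := hconn
              obtain ⟨z', hz'C, hwz'⟩ :=
                exists_central_of_conn_of_ne_branch hcover hwC hww' (by rw [hbr]; exact hsame)
              have hz'M : z' ∉ G.cluster S c := G.not_mem_cluster_c_of_mem_cluster hwM hwz'
              have hz'X : z' ∉ X := hX w z' hwX hwz'
              have hwz'H : G.HAdj S c w z' := Or.inr (Or.inr ⟨hwM, hz'M, hwz'⟩)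
              have hz'w'H : G.HAdj S c z' w' := Or.inr (Or.inr ⟨hz'M, hw'M, hwz'.symm.trans hww'⟩)
              exact Or.inr ⟨hw'C, hw'X, z', w', hz'C, hz'X,
                hR.tail ⟨hzC, hz'C, hzX, hz'X, Or.inr ⟨b₁, w, hb₁C, hb₁X, hzb, hwalk, hwz'H⟩⟩,
                hw'C, hw'X, hz'w'H, Relation.ReflTransGen.refl⟩
    rcases inv h with ⟨_, hR⟩ | ⟨hvC, _⟩
    · exact hR
    · exact absurd hv hvC
  · intro h
    clear hv
    induction h with
    | refl => exact Relation.ReflTransGen.refl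
    | tail _ hzz ih => exact ih.trans hzz.hConnAvoid

/-- `RelC` is `RelB` for one-vertex branches (`br := id`). -/
theorem relC_iff_relB (S : Config E) (c : V) (Cen X : Set V) (z z' : V) :
    G.RelC S c Cen X z z' ↔ G.RelB S c Cen X (id : V → V) z z' := by
  unfold RelC RelB
  refine and_congr_right fun _ => and_congr_right fun _ => and_congr_right fun _ =>
    and_congr_right fun _ => or_congr_right ?_
  constructor
  · rintro ⟨h, hC, hX, h1, h2⟩
    exact ⟨h, h, hC, hX, h1, Relation.ReflTransGen.refl, h2⟩
  · rintro ⟨b₁, b₂, hC, hX, h1, hwalk, h2⟩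
    -- an in-branch walk of one-vertex branches is trivial
    have hb : b₂ = b₁ := (InBranch.end_spec hwalk hC hX rfl).2.2
    subst hb
    exact ⟨b₂, hC, hX, h1, h2⟩

/-- **The contraction lemma** (one-vertex-branch form): every edge has a central endpoint. -/
theorem hConnAvoid_iff_relC (S : Config E) (c : V) (Cen X : Set V)
    (hcover : ∀ e, G.fst e ∈ Cen ∨ G.snd e ∈ Cen)
    (hX : ∀ u v, u ∉ X → G.Conn S u v → v ∉ X) {u v : V} (hu : u ∈ Cen) (hv : v ∈ Cen) :
    G.HConnAvoid S c X u v ↔ Relation.ReflTransGen (G.RelC S c Cen X) u v := by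
  rw [G.hConnAvoid_iff_relB S c Cen X (id : V → V)
    (fun e => (hcover e).elim Or.inl fun h => Or.inr (Or.inl h)) hX hu hv]
  clear hv
  constructor
  · intro h
    induction h with
    | refl => exact Relation.ReflTransGen.refl
    | tail _ hzz ih => exact ih.tail ((G.relC_iff_relB S c Cen X _ _).mpr hzz)
  · intro h
    induction h with
    | refl => exact Relation.ReflTransGen.refl
    | tail _ hzz ih => exact ih.tail ((G.relC_iff_relB S c Cen X _ _).mp hzz)

end HWalkCentral

end MultiGraph

end PercRepro
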